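import Mathlib.Analysis.Fourier.PoissonSummation
import Mathlib.MeasureTheory.Function.JacobianOneDim
import Summits.RiemannHypothesis.RiemannHypothesis.Theorems.SpectralTraceWindowTraceArchStubCausalCrystallisationAux3
import HarnessLib

/-!
# The causal crystallisation identity (`stub_causalCrystallisation`)

Stub `stub_causalCrystallisation` (the lever) of the line `causal-level-sets` for the crux
`WindowTraceArch` (stmt-RiemannHypothesis-11195; skeleton
`Summit.RiemannHypothesis.RiemannHypothesis.Cruxes.WindowTraceArch.CausalLevelSets`).

**Statement.** Let `E` be a Hermite–Biehler function
(`Literature.Analysis.DeBrangesSpaces.IsHermiteBiehler`) with no zeros in `Im z ≥ -δ` (`δ > 0`)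
and `‖E'(z)/E(z)‖ ≤ C(1+|z|)^N` there; let `L`, `α`, `A` be real with `A < 2L`, and let `h` be a
Weil test (`IsWeilTest`) supported in `[-A, A]`, with transform `ĥ(s) = weilMellin h s`. Then
`Σ_{λ ∈ Λ_α} ĥ(1/2 + iλ) = (1/π) ∫ ĥ(1/2+it) (L - Im (E'(t)/E(t))) dt` as a `HasSum` over the
level set `Λ_α = {t : Im (e^{i(α - Lt)} E(t)) = 0}` of the tilted function `e^{-iLz}E(z)`.

**Proof sketch.** If `A < 0` then `h = 0` and both sides vanish. Otherwise `L > A/2 ≥ 0`.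
With the phase `θ` of `E` on `ℝ` (`E = |E|e^{iθ}`, `θ' = Im E'/E`; `causalCLS_phase`) put
`φ̃(t) = Lt - θ(t)`; then `φ̃' = L - Im (E'/E) ≥ L > 0` because `Im (E'/E) ≤ 0` on `ℝ` for a
Hermite–Biehler function (`causalCLS_im_logDeriv_nonpos`),
`Im (e^{i(α-Lt)}E(t)) = |E(t)| sin(α - φ̃(t))`, so `Λ_α = φ̃⁻¹(α + πℤ)`, and
`|φ̃(t)| ≤ c(1+|t|)^{N+1}` by the growth bound on `E'/E`. Poisson summation in the phase variable
(`causalCLS_poisson` below: `φ̃` is an increasing homeomorphism of `ℝ` with inverse `ψ`,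
`F(u) = ĥ(ψ(α + πu))` is continuous and `O(|u|⁻²)` by the Schwartz decay of `ĥ`, the change of
variables `u = (φ̃(t) - α)/π` computes `𝓕F(m) = (1/π)∫ ĥ φ̃' e^{2im(α - φ̃)}`, and Mathlib's
`Real.tsum_eq_tsum_fourier_of_rpow_decay_of_summable` gives `Σ_n F(n) = Σ_m 𝓕F(m)`) reduces the
claim to the vanishing of the alias integrals `∫ ĥ φ̃' e^{2im(α - φ̃)}`, `m ≠ 0`
(`causalCLS_alias_zero`): after one integration by parts they are pairings of `(xh)^` against
`(e^{∓2iLt}(E/E♯)^{±1})^{|m|}`, boundary values of functions holomorphic and bounded by `1` on a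
half-plane times `e^{-2|m|L|y|}`, and the contour can be pushed to `∓i∞` because
`|(xh)^(x+iy)| ≤ C e^{A|y|}/(1+x²)` and `A < 2L` (`causalCLS_integral_eq_zero_of_holo`, via the
tree's `Literature.Analysis.Fourier.fourier_upperSlice_eq_zero_of_neg`).

**Sources.** L. de Branges, *Hilbert Spaces of Entire Functions* (1968), §22 (phase functions,
sampling sets `φ(t) ≡ α mod π`); Poisson summation (Stein–Weiss (1971), Cor. VII.2.6, as in
Mathlib). All ingredients are proved tree / Mathlib facts.
-/

set_option linter.dupNamespace false

noncomputable section

open Complex Set MeasureTheory Filter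
open scoped Real Topology FourierTransform

namespace Summit.RiemannHypothesis.RiemannHypothesis.Theorems.SpectralTraceWindowTraceArch

open Literature.NumberTheory.LFunctions
open Literature.Analysis.DeBrangesSpaces (IsHermiteBiehler sharp)

/-! ### Poisson summation in the phase variable -/

/-- **Poisson summation in the phase variable (abstract crystallisation).** Let `ph : ℝ → ℝ` be
differentiable with `ph' ≥ L > 0`, `G : ℝ → ℂ` continuous with `‖G(t)‖ (1 + |ph t|)² ≤ C`, and
suppose the alias integrals `∫ G ph' e^{2im(α - ph)}` vanish for every integer `m ≠ 0`. Then `G`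
summed over the level set `{t : ph t ∈ α + πℤ}` (described by the predicate `Q`) converges
unconditionally to `(1/π) ∫ G ph'`. Proof: `ph` is an increasing homeomorphism of `ℝ` with
inverse `ψ`; the function `F(u) = G(ψ(α + πu))` is continuous and `O(|u|⁻²)`, its Fourier
transform is `𝓕F(w) = ∫ (ph'/π) e^{2iw(α - ph)} G` (change of variables `u = (ph t - α)/π`,
`MeasureTheory.integral_image_eq_integral_abs_deriv_smul`), so `𝓕F(m) = 0` for `m ≠ 0` and
Mathlib's Poisson summation formula `Real.tsum_eq_tsum_fourier_of_rpow_decay_of_summable` gives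
`Σ_n F(n) = 𝓕F(0)`; finally transport along the bijection `n ↦ ψ(α + πn)` onto the level set. -/
theorem causalCLS_poisson {ph ph' : ℝ → ℝ} {G : ℝ → ℂ} {α L C : ℝ} {Q : ℝ → Prop}
    (hder : ∀ t, HasDerivAt ph (ph' t) t) (hL : 0 < L) (hph' : ∀ t, L ≤ ph' t)
    (hG : Continuous G) (hdec : ∀ t, ‖G t‖ * (1 + |ph t|) ^ 2 ≤ C)
    (hzero : ∀ m : ℤ, m ≠ 0 →
      ∫ t, G t * (ph' t : ℂ) * cexp (((2 * (m : ℝ) * (α - ph t) : ℝ) : ℂ) * I) = 0)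
    (hQ : ∀ t, Q t ↔ ∃ n : ℤ, ph t = α + π * n) :
    HasSum (fun l : {t : ℝ // Q t} => G l) ((1 / (π : ℂ)) * ∫ t, G t * (ph' t : ℂ)) := by
  have hπ := Real.pi_pos
  -- `ph` is an increasing homeomorphism of `ℝ`
  have hmono : StrictMono ph :=
    strictMono_of_hasDerivAt_pos hder (fun t => hL.trans_le (hph' t))
  have hcont : Continuous ph := continuous_iff_continuousAt.2 fun t => (hder t).continuousAt
  have hdiff : Differentiable ℝ ph := fun t => (hder t).differentiableAt
  have hgrow : ∀ s t : ℝ, s ≤ t → L * (t - s) ≤ ph t - ph s := fun s t hst =>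
    mul_sub_le_image_sub_of_le_deriv hdiff (fun x => by rw [(hder x).deriv]; exact hph' x) hst
  have htop : Tendsto ph atTop atTop := by
    refine tendsto_atTop_atTop.2 fun b => ⟨max 0 ((b - ph 0) / L), fun t ht => ?_⟩
    have ht0 : 0 ≤ t := le_trans (le_max_left _ _) ht
    have ht1 : (b - ph 0) / L ≤ t := le_trans (le_max_right _ _) ht
    have h1 := hgrow 0 t ht0
    rw [div_le_iff₀ hL] at ht1
    linarith
  have hbot : Tendsto ph atBot atBot := by
    refine tendsto_atBot_atBot.2 fun b => ⟨min 0 ((b - ph 0) / L), fun t ht => ?_⟩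
    have ht0 : t ≤ 0 := le_trans ht (min_le_left _ _)
    have ht1 : t ≤ (b - ph 0) / L := le_trans ht (min_le_right _ _)
    have h1 := hgrow t 0 ht0
    rw [le_div_iff₀ hL] at ht1
    linarith
  have hsurj : Function.Surjective ph := hcont.surjective htop hbot
  set e : ℝ ≃o ℝ := hmono.orderIsoOfSurjective ph hsurj with he_def
  have he : ∀ t, e t = ph t := fun t => rfl
  set ψ : ℝ → ℝ := fun u => e.symm u with hψ_def
  have hψc : Continuous ψ := e.symm.continuous
  have hψ1 : ∀ u, ph (ψ u) = u := fun u => by rw [← he]; exact e.apply_symm_apply u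
  have hψ2 : ∀ t, ψ (ph t) = t := fun t => by rw [← he]; exact e.symm_apply_apply t
  -- the function `F(u) = G(ψ(α + π u))`
  set F : ℝ → ℂ := fun u => G (ψ (α + π * u)) with hF
  have hFc : Continuous F := hG.comp (hψc.comp (by fun_prop))
  -- its Fourier transform, by the change of variables `u = (ph t - α)/π`
  have hFT : ∀ w : ℝ, 𝓕 F w =
      ∫ t, ((ph' t / π : ℝ) : ℂ) * (cexp (((2 * w * (α - ph t) : ℝ) : ℂ) * I) * G t) := by
    intro w
    rw [Real.fourier_real_eq_integral_exp_smul]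
    set Ψ : ℝ → ℝ := fun t => (ph t - α) / π with hΨ
    have hΨd : ∀ t, HasDerivAt Ψ (ph' t / π) t := fun t => ((hder t).sub_const α).div_const π
    have hΨmono : StrictMono Ψ := (hmono.add_const (-α)).div_const hπ
    have hΨinj : InjOn Ψ univ := hΨmono.injective.injOn
    have hΨsurj : Ψ '' univ = univ := by
      rw [image_univ, Set.range_eq_univ]
      intro u
      refine ⟨ψ (α + π * u), ?_⟩
      simp only [hΨ, hψ1]
      field_simp
      ring
    have hcv := integral_image_eq_integral_abs_deriv_smul MeasurableSet.univ
      (fun t _ => (hΨd t).hasDerivWithinAt) hΨinj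
      (fun v => cexp (((-2 * π * v * w : ℝ) : ℂ) * I) • F v)
    rw [hΨsurj, Measure.restrict_univ] at hcv
    rw [hcv]
    refine integral_congr_ae (Eventually.of_forall fun t => ?_)
    have hpos : 0 < ph' t / π := div_pos (hL.trans_le (hph' t)) hπ
    simp only [hΨ, hF]
    rw [abs_of_pos hpos, Complex.real_smul, smul_eq_mul]
    congr 2
    · congr 1
      push_cast
      field_simp
      ring
    · congr 1
      rw [← hψ2 t]
      congr 1
      rw [hψ2]
      field_simp
      ring
  have hFT0 : 𝓕 F 0 = (1 / (π : ℂ)) * ∫ t, G t * (ph' t : ℂ) := by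
    rw [hFT 0, ← integral_const_mul]
    refine integral_congr_ae (Eventually.of_forall fun t => ?_)
    simp only [mul_zero, zero_mul, Complex.ofReal_zero, Complex.exp_zero, one_mul]
    push_cast
    ring
  have hFTm : ∀ m : ℤ, m ≠ 0 → 𝓕 F m = 0 := by
    intro m hm
    rw [hFT m]
    calc ∫ t, ((ph' t / π : ℝ) : ℂ) * (cexp (((2 * (m : ℝ) * (α - ph t) : ℝ) : ℂ) * I) * G t)
        = (1 / (π : ℂ)) * ∫ t, G t * (ph' t : ℂ) *
            cexp (((2 * (m : ℝ) * (α - ph t) : ℝ) : ℂ) * I) := by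
          rw [← integral_const_mul]
          refine integral_congr_ae (Eventually.of_forall fun t => ?_)
          push_cast
          ring
      _ = 0 := by rw [hzero m hm, mul_zero]
  -- decay of `F`
  have hC0 : 0 ≤ C := le_trans (by positivity) (hdec 0)
  set c₀ : ℝ := 1 + |α| / π + 1 / π with hc₀_def
  have hc₀ : ∀ u : ℝ, 1 + |u| ≤ c₀ * (1 + |α + π * u|) := by
    intro u
    have h1 : π * |u| ≤ |α + π * u| + |α| := by
      have := abs_sub (α + π * u) α
      rwa [add_sub_cancel_left, abs_mul, abs_of_pos hπ] at this
    have h2 : |u| ≤ |α + π * u| / π + |α| / π := by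
      rw [← add_div, le_div_iff₀ hπ]
      linarith
    have h3 : 0 ≤ |α + π * u| := abs_nonneg _
    have h4 : 0 ≤ |α| / π := by positivity
    have h5 : |α + π * u| / π ≤ (1 / π) * (1 + |α + π * u|) := by
      rw [div_eq_mul_one_div, mul_comm]
      exact mul_le_mul_of_nonneg_left (by linarith) (by positivity)
    rw [hc₀_def]
    nlinarith
  have hFbound : ∀ u, ‖F u‖ * (1 + |u|) ^ 2 ≤ c₀ ^ 2 * C := by
    intro u
    have h1 := hdec (ψ (α + π * u))
    rw [hψ1] at h1
    have hc₀0 : 0 ≤ c₀ := by rw [hc₀_def]; positivity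
    calc ‖F u‖ * (1 + |u|) ^ 2 ≤ ‖F u‖ * (c₀ * (1 + |α + π * u|)) ^ 2 := by
          gcongr
          exact hc₀ u
      _ = c₀ ^ 2 * (‖G (ψ (α + π * u))‖ * (1 + |α + π * u|) ^ 2) := by
          simp only [hF]; ring
      _ ≤ c₀ ^ 2 * C := by gcongr
  have hFO : F =O[cocompact ℝ] fun x : ℝ => |x| ^ (-(2 : ℝ)) := by
    refine Asymptotics.IsBigO.of_bound (c₀ ^ 2 * C) ?_
    have hmem : (Icc (-1 : ℝ) 1)ᶜ ∈ cocompact ℝ := isCompact_Icc.compl_mem_cocompact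
    filter_upwards [hmem] with u hu
    have hu1 : 1 ≤ |u| := by
      simp only [mem_compl_iff, mem_Icc, not_and_or, not_le] at hu
      rcases hu with h | h
      · rw [abs_of_neg (by linarith)]; linarith
      · rw [abs_of_pos (by linarith)]; linarith
    have hupos : 0 < |u| := by linarith
    rw [Real.norm_of_nonneg (by positivity), Real.rpow_neg (abs_nonneg u), Real.rpow_two,
      ← div_eq_mul_inv, le_div_iff₀ (by positivity)]
    calc ‖F u‖ * |u| ^ 2 ≤ ‖F u‖ * (1 + |u|) ^ 2 := by
          gcongr
          linarith [abs_nonneg u]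
      _ ≤ c₀ ^ 2 * C := hFbound u
  -- Poisson summation
  have hsumFT : Summable fun n : ℤ => 𝓕 F n :=
    summable_of_ne_finset_zero (s := {0}) (fun n hn => hFTm n (by simpa using hn))
  have hP := Real.tsum_eq_tsum_fourier_of_rpow_decay_of_summable hFc one_lt_two hFO hsumFT 0
  have hR : ∑' n : ℤ, 𝓕 F n * fourier n ((0 : ℝ) : UnitAddCircle) = 𝓕 F 0 := by
    have h1 : ∀ n : ℤ, 𝓕 F n * fourier n ((0 : ℝ) : UnitAddCircle) = 𝓕 F n := fun n => by
      rw [QuotientAddGroup.mk_zero, fourier_eval_zero, mul_one]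
    simp_rw [h1]
    rw [tsum_eq_single (0 : ℤ) (fun n hn => hFTm n hn), Int.cast_zero]
  simp only [zero_add] at hP
  rw [hR] at hP
  have hsumF : Summable fun n : ℤ => F n :=
    summable_of_isBigO (Real.summable_abs_int_rpow one_lt_two)
      (hFO.comp_tendsto Int.tendsto_coe_cofinite)
  have hZ : HasSum (fun n : ℤ => F n) ((1 / (π : ℂ)) * ∫ t, G t * (ph' t : ℂ)) := by
    rw [← hFT0, ← hP]
    exact hsumF.hasSum
  -- transport along the bijection `ℤ ≃ {t // Q t}`, `n ↦ ψ(α + πn)`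
  have hmemQ : ∀ n : ℤ, Q (ψ (α + π * n)) := fun n => (hQ _).2 ⟨n, hψ1 _⟩
  let f : ℤ → {t : ℝ // Q t} := fun n => ⟨ψ (α + π * n), hmemQ n⟩
  have hf : Function.Bijective f := by
    constructor
    · intro m n hmn
      have h1 : ψ (α + π * m) = ψ (α + π * n) := congrArg Subtype.val hmn
      have h2 := congrArg ph h1
      rw [hψ1, hψ1, add_right_inj] at h2
      have h3 : (m : ℝ) = n := (mul_right_injective₀ hπ.ne') h2
      exact_mod_cast h3
    · rintro ⟨t, ht⟩
      obtain ⟨n, hn⟩ := (hQ t).1 ht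
      refine ⟨n, Subtype.ext ?_⟩
      show ψ (α + π * n) = t
      rw [← hn, hψ2]
  set eqv : ℤ ≃ {t : ℝ // Q t} := Equiv.ofBijective f hf with heqv
  have hcomp : (fun l : {t : ℝ // Q t} => G l) ∘ eqv = fun n : ℤ => F n := by
    funext n
    rfl
  rw [← Equiv.hasSum_iff eqv, hcomp]
  exact hZ

/-! ### The stub -/

/-- **stub_causalCrystallisation — the causal crystallisation (CLS) identity.** For a
Hermite–Biehler function `E` with no zeros in `Im z ≥ -δ` and `‖E'/E‖ ≤ C(1+|z|)^N` there, a tilt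
`L`, a phase `α` and a window `A < 2L`: for every Weil test `h` supported in `[-A, A]`, the
transform `ĥ(1/2+iλ)` summed over the level set `Λ_α = {t : Im (e^{i(α - Lt)} E(t)) = 0}` of the
tilted function `e^{-iLz}E(z)` converges unconditionally to `(1/π) ∫ ĥ(1/2+it)(L - Im E'(t)/E(t)) dt`.
Proof: with the phase `θ` of `E` on `ℝ` (`causalCLS_phase`) the tilted phase `φ̃(t) = Lt - θ(t)`
has `φ̃' = L - Im (E'/E) ≥ L > 0` (`causalCLS_im_logDeriv_nonpos`; `L > 0` because `0 ≤ A < 2L`,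
the case `A < 0` forcing `h = 0`), the level set is `φ̃⁻¹(α + πℤ)`, and Poisson summation in the
phase variable (`causalCLS_poisson`) applies because the alias integrals vanish
(`causalCLS_alias_zero`: integrate by parts and close the contour in the half-plane where
`e^{∓2imLz}(E/E♯)^{±m}` is bounded, using `A < 2L`). -/
theorem stub_causalCrystallisation :
    ∀ (E : ℂ → ℂ) (L δ C : ℝ) (N : ℕ), IsHermiteBiehler E → 0 < δ →
      (∀ z : ℂ, -δ ≤ z.im → E z ≠ 0) →
      (∀ z : ℂ, -δ ≤ z.im → ‖deriv E z / E z‖ ≤ C * (1 + ‖z‖) ^ N) →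
      ∀ (α A : ℝ), A < 2 * L →
      ∀ h : ℝ → ℂ, IsWeilTest h → tsupport h ⊆ Icc (-A) A →
        HasSum
          (fun l : {t : ℝ // (cexp (((α - L * t : ℝ) : ℂ) * I) * E t).im = 0} =>
            weilMellin h (1 / 2 + ((l : ℝ) : ℂ) * I))
          ((1 / (π : ℂ)) * ∫ t : ℝ, weilMellin h (1 / 2 + (t : ℂ) * I) *
            (((L - (deriv E t / E t).im : ℝ)) : ℂ)) := by
  intro E L δ C N hE hδ h0 hgr α A hAL h hh hhA
  -- the degenerate case `A < 0`: `h = 0`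
  by_cases hA : A < 0
  · have hz : ∀ x, h x = 0 := fun x => image_eq_zero_of_notMem_tsupport (fun hx => by
      have h1 := hhA hx
      rw [mem_Icc] at h1
      linarith [h1.1, h1.2])
    have hM : ∀ s, weilMellin h s = 0 := fun s => by simp [weilMellin, hz]
    simp only [hM, zero_mul, integral_zero, mul_zero]
    exact hasSum_zero
  have hA' : 0 ≤ A := not_lt.1 hA
  have hL : 0 < L := by linarith
  have hπ := Real.pi_pos
  -- real points lie in the zero-free region
  have h0r : ∀ t : ℝ, E t ≠ 0 := fun t => h0 t (by simp; exact hδ.le)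
  have hgrr : ∀ t : ℝ, ‖deriv E t / E t‖ ≤ C * (1 + |t|) ^ N := fun t => by
    have h1 := hgr t (by simp; exact hδ.le)
    simpa [Complex.norm_real] using h1
  have hC : 0 ≤ C := by
    have h1 := (norm_nonneg _).trans (hgrr 0)
    simpa using h1
  -- the phase and the tilted phase
  obtain ⟨θ, hθd, hθ⟩ := causalCLS_phase hE.differentiable h0r
  set ℓ : ℝ → ℂ := fun t => deriv E t / E t with hℓ
  set ph : ℝ → ℝ := fun t => L * t - θ t with hph
  set ph' : ℝ → ℝ := fun t => L - (ℓ t).im with hph'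
  have hder : ∀ t, HasDerivAt ph (ph' t) t := fun t => by
    have h1 : HasDerivAt (fun s : ℝ => L * s - θ s) (L * 1 - (deriv E t / E t).im) t :=
      ((hasDerivAt_id t).const_mul L).fun_sub (hθd t)
    simp only [hph, hph', hℓ]
    convert h1 using 1
    ring
  have hph'L : ∀ t, L ≤ ph' t := fun t => by
    have h1 := causalCLS_im_logDeriv_nonpos hE t (h0r t)
    simp only [hph', hℓ]
    linarith
  have hph'b : ∀ t, ph' t ≤ L + C * (1 + |t|) ^ N := fun t => by
    have h1 : |(ℓ t).im| ≤ ‖ℓ t‖ := Complex.abs_im_le_norm _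
    have h2 := hgrr t
    have h3 := neg_abs_le (ℓ t).im
    simp only [hph']
    linarith
  -- growth of the tilted phase
  have hphg : ∀ t, |ph t - ph 0| ≤ (L + C * (1 + |t|) ^ N) * |t| := by
    intro t
    have hb : ∀ x ∈ uIcc 0 t, ‖ph' x‖ ≤ L + C * (1 + |t|) ^ N := by
      intro x hx
      have hxt : |x| ≤ |t| := by
        rcases mem_uIcc.1 hx with h1 | h1
        · rw [abs_of_nonneg h1.1, abs_of_nonneg (h1.1.trans h1.2)]; exact h1.2
        · rw [abs_of_nonpos h1.2, abs_of_nonpos (h1.1.trans h1.2)]; linarith [h1.1]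
      rw [Real.norm_eq_abs, abs_of_pos (hL.trans_le (hph'L x))]
      calc ph' x ≤ L + C * (1 + |x|) ^ N := hph'b x
        _ ≤ L + C * (1 + |t|) ^ N := by gcongr
    have h1 := (convex_uIcc 0 t).norm_image_sub_le_of_norm_hasDerivWithin_le
      (fun x _ => (hder x).hasDerivWithinAt) hb left_mem_uIcc right_mem_uIcc
    simpa using h1
  set c₁ : ℝ := 1 + |ph 0| + L + C with hc₁_def
  have hph_abs : ∀ t, 1 + |ph t| ≤ c₁ * (1 + |t|) ^ (N + 1) := by
    intro t
    have h1 := hphg t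
    have h2 : |ph t| ≤ |ph 0| + |ph t - ph 0| := by
      have := abs_add_le (ph 0) (ph t - ph 0)
      rwa [add_sub_cancel] at this
    have ht1 : 1 ≤ 1 + |t| := by linarith [abs_nonneg t]
    have h3 : 1 ≤ (1 + |t|) ^ (N + 1) := one_le_pow₀ ht1
    have ha : |t| ≤ (1 + |t|) ^ (N + 1) :=
      le_trans (by linarith) (le_self_pow₀ ht1 (Nat.succ_ne_zero N))
    have hb : (1 + |t|) ^ N * |t| ≤ (1 + |t|) ^ (N + 1) := by
      rw [pow_succ]
      gcongr
      linarith
    have h4 : L * |t| ≤ L * (1 + |t|) ^ (N + 1) := mul_le_mul_of_nonneg_left ha hL.le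
    have h5 : C * ((1 + |t|) ^ N * |t|) ≤ C * (1 + |t|) ^ (N + 1) :=
      mul_le_mul_of_nonneg_left hb hC
    have h6 : (1 + |ph 0|) * 1 ≤ (1 + |ph 0|) * (1 + |t|) ^ (N + 1) :=
      mul_le_mul_of_nonneg_left h3 (by positivity)
    rw [hc₁_def]
    nlinarith
  -- the function summed: `ĥ` on the critical line
  set G : ℝ → ℂ := fun t => weilMellin h (1 / 2 + (t : ℂ) * I) with hG
  have hGc : Continuous G := (continuous_weilMellin hh.1.continuous hh.2).comp (by fun_prop)
  obtain ⟨C₂, hC₂, hdec₂⟩ := causalCLS_weil_decay_poly (2 * N + 2) hh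
  have hdec : ∀ t, ‖G t‖ * (1 + |ph t|) ^ 2 ≤ c₁ ^ 2 * C₂ := by
    intro t
    have h1 := hdec₂ t
    have h2 : C₂ / (1 + t ^ 2) ≤ C₂ := div_le_self hC₂ (by nlinarith)
    have h3 := hph_abs t
    have hc₁ : 0 ≤ c₁ := by rw [hc₁_def]; positivity
    calc ‖G t‖ * (1 + |ph t|) ^ 2 ≤ ‖G t‖ * (c₁ * (1 + |t|) ^ (N + 1)) ^ 2 := by gcongr
      _ = c₁ ^ 2 * ((1 + |t|) ^ (2 * N + 2) * ‖G t‖) := by ring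
      _ ≤ c₁ ^ 2 * C₂ := by gcongr; exact h1.trans h2
  -- the level set is `φ̃⁻¹(α + πℤ)`
  have hQ : ∀ t : ℝ, (cexp (((α - L * t : ℝ) : ℂ) * I) * E t).im = 0 ↔
      ∃ n : ℤ, ph t = α + π * n := by
    intro t
    have e1 : cexp (((α - L * t : ℝ) : ℂ) * I) * E t =
        ((‖E t‖ : ℝ) : ℂ) * cexp (((α - ph t : ℝ) : ℂ) * I) := by
      have hEt := hθ t
      set r : ℝ := ‖E t‖ with hr
      rw [hEt, mul_left_comm, ← Complex.exp_add]
      congr 2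
      simp only [hph]
      push_cast
      ring
    rw [e1, Complex.im_ofReal_mul, Complex.exp_ofReal_mul_I_im, mul_eq_zero]
    constructor
    · rintro (h1 | h1)
      · exact absurd (norm_eq_zero.1 h1) (h0r t)
      · obtain ⟨n, hn⟩ := Real.sin_eq_zero_iff.1 h1
        exact ⟨-n, by push_cast; linarith⟩
    · rintro ⟨n, hn⟩
      right
      rw [Real.sin_eq_zero_iff]
      exact ⟨-n, by push_cast; linarith⟩
  -- the alias integrals vanish
  have hzero : ∀ m : ℤ, m ≠ 0 →
      ∫ t, G t * (ph' t : ℂ) * cexp (((2 * (m : ℝ) * (α - ph t) : ℝ) : ℂ) * I) = 0 :=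
    fun m hm => causalCLS_alias_zero _ _ _ _ _ _ _ _ α m hE hδ h0 hgrr hθd hθ hL hAL hh hhA hm
  -- Poisson summation in the phase variable
  exact causalCLS_poisson (Q := fun t => (cexp (((α - L * t : ℝ) : ℂ) * I) * E t).im = 0)
    hder hL hph'L hGc hdec hzero hQ

end Summit.RiemannHypothesis.RiemannHypothesis.Theorems.SpectralTraceWindowTraceArch

end
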